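import Summits.QuantumFields.YangMills.Theorems.BalabanUVNodesN15TwoGridStability
import Summits.QuantumFields.YangMills.Theorems.BalabanUVNodesN15TwoGridLocality
import Literature.MathematicalPhysics.QuantumFieldTheory.Balaban1983to89.B5GlobCoverP12Lattice
import Literature.MathematicalPhysics.QuantumFieldTheory.Balaban1983to89.B5SupHolderTorus
import HarnessLib

/-!
# Route «BalabanUVNodes», node N15 = NE2, -a lane, part 41: DOOR (iv) R3-H — BAŁABAN's HÖLDER ENTRY (1.111) READ AS THE `η^α` GAIN OF THE
# COARSE-STEP GRADIENT DIFFERENCE `ρ(n(s_ν−1))∘ρ(n(s_{ν′}−1))∘G` IN BLOCK-MAJORANT CURRENCY (`C·n^{1−α}·e^{−δ₀|y−y′|_T}`), HYPOTHESIS-FREE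

Cell `pub-ymgap`, seat `pub-ymgap-dag-n15-a` (KNIT-BY-NAME, g11); `--supports stmt-QuantumFields-19910 --as helper`; `HOME/pub-ymgap-dag-n15-a/DOOR-IV-PLAN.md` §7.1(ii)∕§7.2
(route R, file R3-H).  Over parts 39∕40 (`…N15TwoGridStability`: `gOp`, the (1.110) entries; `…N15TwoGridLocality`: the transfer calculus).
WHY.  In the resolvent identity `𝔇(G′,G) = −G′(Δ′_aP̂₂ − PΔ_a)G` the Laplacian part of the consistency operator is (part 35 `lap_sSm_comm_comp_pull`)
`Σ_ν ρ′(sD_ν c′·k_ν)∘P∘ρ(sD_ν c)²` with `‖ρ′(k_ν)‖ = O(η)` (parts 35∕40); the remaining factor `ρ(sD_ν c)²G = ρ(n(s_ν−1))∘∇_νG` is a SECOND difference quotient of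
`G` — `O(η⁻¹)` in sup norm by (1.110) alone.  Bałaban's Hölder entry (1.111) `‖ζ∇GJ‖_α ≤ O(1)e^{−δ₀|y−y′|}(‖ζ‖_α + |ζ|)|J|` turns one coarse step of `∇G` into
`η^α`: `|∇Gμ(x + ηe_ν) − ∇Gμ(x)| ≤ ‖ζ∇Gμ‖_α·η^α` for a cut-off `ζ = 1` at both points — net `η·∇∇G = O(η^α)`.  THIS FILE proves exactly that, in the lineage's
`B11SectG.HasMaj (BlockNorm.ofBlocks (unitTorusGeo L K M) blkFine)` currency, from the tree's `B5Prop12GHolds.prop12_famG_printed` and lit-balaban's cut-off kit BY NAME: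
`B5CoverP12Lattice.cutP`∕`nearOf` (plateau cut-off of `Δ̃(nearOf x)`, `= 1` within `¼` of `x`), `B5GlobCoverP12Lattice.cutH_le` (`‖ζ‖_α + |ζ| ≤ Lθ + 1`),
`B5SupHolderTorus.abs_sub_le_holderT_mul` (pair bound from `holderT`), `B5CombesThomasLattice.distU_step_le`.
CONTENTS.  §20 dictionary `smulT_grad_inv_mulVec_ofReal`, ★ `h1L_vec_eq` (`h1L (vec μ) α ζ` = `holderT` of the real fields `ζ·ρ(n(s_ν−1))Gμ`).  §21 `distU_step_pos`
(`|x − (x+e_ν)| > 0`, `n ≥ 2`), `tdistT_nearOf_blockOf_le` (`|nearOf x − B(x)|_T ≤ 1`: `round` vs `⌊·⌋`).  §22 ★ `abs_gradStep_le_of_ineq` (one fine step on `∇G` costs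
`C_α e^{−δ₀|nearOf x − y′|}(‖ζ‖_α+|ζ|)|μ|·η^α`, any setting satisfying `B5.Ineq110_114`, `n ≥ 4`), ★★ `hasMaj_gradStep_of_ineq` (`HasMaj … (ρ(sD_ν n)∘ρ(sD_{ν′} n)∘gOp)
(|C_α|(Lθ+1)e^{δ₀}·n^{1−α}·e^{−δ₀ tdistT})`, generic `n ≥ 4`, `M_μ ≥ 2`).  §23 `hasMaj_sD_comp` (crude: `ρ(c(s_ν−1))∘T` costs `2c e^{ρ}`, part 40).  §24 ★★ **`hasMaj_gradStep`**:
the family of record (`M_μ = 2L^m`, `n = L^K`), `∃ δ₀ C > 0 ∀ m K ≥ 1 ∀ ν ν′`, majorant `C·(L^K)^{1−α}·e^{−δ₀ tdistT}` — Hölder route for `L^K ≥ 4`, (1.110) + §23 for `L^K < 4`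
(`n ≤ 4^α n^{1−α}`), one pair `(δ₀, C) = (min, sum)`.
HONEST FRAMING ∕ LIMITS.  Dictionary + bookkeeping over the tree's theorem `prop12_famG_printed` (its Combes–Thomas route and disclosed divergences) and lit-balaban's cut-off
geometry; constants ours and crude (`|C_α(α)|`, `e^{δ₀}` for the one-unit offset `nearOf x` vs `B(x)`); tori of record only; `U ≡ 1`; the η-RATE of `𝔇(G′,G)` itself (R3
assembly: `idef_inv` + parts 34∕35∕37∕39∕40 + this) is NOT here, nor the Landau piece `∂Π∂*` of `Δ_a` (plan §7.4(a)), nor entries 2–3; count-neutral (typed 28∕28 ·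
discharged 5∕28 unchanged); NOT a discharge of N15 (object-bound; NE2⁺ NOT PRINTED); one finite T⁴ at fixed ε — NOT infinite volume, NOT OS on ℝ⁴, NOT a mass gap, NOT Clay.
-/

noncomputable section

open scoped BigOperators Matrix
open Finset

namespace Summit.QuantumFields.YangMills.BalabanUVNodes.N15.TwoGrid

open Literature.MathematicalPhysics.QuantumFieldTheory.Balaban1983to89
open Literature.MathematicalPhysics.QuantumFieldTheory.Balaban1983to89.B11SectG (BlockNorm HasMaj)
open Literature.MathematicalPhysics.QuantumFieldTheory.Balaban1983to89.B11AxialTransport190 (abs_le_loc_ofBlocks loc_ofBlocks_le)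
open Literature.MathematicalPhysics.QuantumFieldTheory.Balaban1983to89.B5Prop11Plancherel (Tor fine unitVec fdiff)
open Literature.MathematicalPhysics.QuantumFieldTheory.Balaban1983to89.B5DeltaA169 (DeltaA)
open Literature.MathematicalPhysics.QuantumFieldTheory.Balaban1983to89.B5RealFields (cplx)
open Literature.MathematicalPhysics.QuantumFieldTheory.Balaban1983to89.B5Prop12FieldsLattice (cubeT cdistF toFine distSite distU suppInL supNormL h1L holderT
  smulT cutInL cutHL distU_nonneg distSite_nonneg supNormL_nonneg cutHL_nonneg)
open Literature.MathematicalPhysics.QuantumFieldTheory.Balaban1983to89.B5Prop11Lattice (grad)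
open Literature.MathematicalPhysics.QuantumFieldTheory.Balaban1983to89.B5SettingP12Real (LocR VecR latticeSettingP12R)
open Literature.MathematicalPhysics.QuantumFieldTheory.Balaban1983to89.B5SiteBridgeP12 (nP MP distU_eq_distSite_div)
open Literature.MathematicalPhysics.QuantumFieldTheory.Balaban1983to89.B5Prop12GHolds (prop12_famG_printed)
open Literature.MathematicalPhysics.QuantumFieldTheory.Balaban1983to89.B5CoverP12Lattice (cutP nearOf uc Lθ Lθ_nonneg cutP_nearOf_eq_one
  cutP_nearOf_eq_one_of_distU_le cutInL_cutP)
open Literature.MathematicalPhysics.QuantumFieldTheory.Balaban1983to89.B5GlobCoverP12Lattice (cutH_le)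
open Literature.MathematicalPhysics.QuantumFieldTheory.Balaban1983to89.B5SupHolderTorus (abs_sub_le_holderT_mul)
open Literature.MathematicalPhysics.QuantumFieldTheory.Balaban1983to89.B5CombesThomasLattice (distU_step_le)
open Literature.MathematicalPhysics.QuantumFieldTheory.Balaban1983to89.B5RowSumsP12Lattice (distSite_triangle)
open Literature.MathematicalPhysics.QuantumFieldTheory.Balaban1983to89.B4TorusKernel.MultiPeriod (circAbs circAbs_add_mul circAbs_le_abs)
open Literature.MathematicalPhysics.QuantumFieldTheory.Balaban1983to89.LatticeNorms (supNorm norm_le_supNorm supNorm_le supNorm_nonneg holderSeminorm_nonneg)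
open Literature.MathematicalPhysics.QuantumFieldTheory.King1986.Torus (blockOf val_blockOf tdistT tdistT_nonneg tdistT_symm tdistT_le_of_coord one_le_period)
open Literature.MathematicalPhysics.QuantumFieldTheory.Balaban1983to89.B6UnitTorusCarrier (unitTorusGeo)
open Summit.QuantumFields.YangMills.BalabanUVNodes.N15.VectorPiece (blkFine)

variable {d : ℕ}

/-! ## §20 Dictionary: the (1.111) functional `‖ζ∇GJ‖_α` at an embedded real source is the tensor Hölder seminorm of the real fields `ζ·ρ(n(s_ν−1))(Gμ)` -/

section Dict

variable (M : Fin (d + 1) → ℕ) [∀ μ, NeZero (M μ)] (n : ℕ) [NeZero n] (a : ℝ)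

/-- `ζ·∇(GJ)` at the embedded real source `J = μ` is the embedding of the real tensor field `(ν, b) ↦ ζ(b.1)·ρ(n(s_ν − 1))(Gμ)(b)`.
[cite: Balaban1984PropagatorsI, Prop. 1.2 (1.111) p.35 (ζ∇GJ)] -/
theorem smulT_grad_inv_mulVec_ofReal (ζ : Tor (fine n M) → ℝ) (μ : Tor (fine n M) × Fin (d + 1) → ℝ) :
    smulT n M ζ (grad n M ((DeltaA n M a)⁻¹ *ᵥ fun i => ((μ i : ℝ) : ℂ)))
      = fun ν => cplx (fun b => ζ b.1 * symbOp M n (sD M n ν n) (gOp M n a μ) b) := by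
  have hG : ((DeltaA n M a)⁻¹ *ᵥ fun i => ((μ i : ℝ) : ℂ)) = fun i => ((gOp M n a μ i : ℝ) : ℂ) :=
    funext fun i => DeltaA_inv_mulVec_ofReal M n a μ i
  funext ν b
  simp only [smulT, grad, cplx]
  rw [hG, fdiff_mulVec_ofReal, Complex.ofReal_mul]

/-- **DICTIONARY FOR (1.111)**: `h1L (vec μ) α ζ = ‖(ζ·ρ(n(s_ν−1))Gμ)_ν‖_α` (b05's tensor Hölder seminorm `holderT` of the embedded real fields).
[cite: Balaban1984PropagatorsI, Prop. 1.2 (1.111) p.35] -/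
theorem h1L_vec_eq (α : ℝ) (ζ : Tor (fine n M) → ℝ) (μ : Tor (fine n M) × Fin (d + 1) → ℝ) :
    h1L n M a (LocR.vec μ).emb α ζ = holderT n M α (fun ν => cplx (fun b => ζ b.1 * symbOp M n (sD M n ν n) (gOp M n a μ) b)) := by
  show holderT n M α (smulT n M ζ (grad n M ((DeltaA n M a)⁻¹ *ᵥ fun i => ((μ i : ℝ) : ℂ)))) = _
  rw [smulT_grad_inv_mulVec_ofReal]

end Dict

/-! ## §21 Geometry: one fine step has length exactly `η = 1/n`; the nearest unit-lattice point of a site is within one unit of its King block -/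

section Geometry

variable (M : Fin (d + 1) → ℕ) [∀ μ, NeZero (M μ)] (n : ℕ) [NeZero n]

/-- `0 < |x − (x + e_ν)|` (`n ≥ 2`). [cite: Balaban1984PropagatorsI, (1.109) p.35 (|x − x′|)] -/
theorem distU_step_pos (hn : 2 ≤ n) (x : Tor (fine n M)) (ν : Fin (d + 1)) : 0 < distU n M x (x + unitVec (fine n M) ν) := by
  rw [distU_eq_distSite_div]
  have hn0 : (0 : ℝ) < n := by exact_mod_cast (show 0 < n by omega)
  refine div_pos ?_ hn0
  have hN : 2 ≤ fine n M ν := le_trans hn (Nat.le_mul_of_pos_right n (Nat.pos_of_ne_zero (NeZero.ne (M ν))))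
  have h1 : ((x ν - (x + unitVec (fine n M) ν) ν).valMinAbs).natAbs = 1 := by
    have e : x ν - (x + unitVec (fine n M) ν) ν = -(((1 : ℕ) : ℕ) : ZMod (fine n M ν)) := by
      rw [Pi.add_apply, unitVec, Pi.single_eq_same]; push_cast; ring
    rw [e, ZMod.natAbs_valMinAbs_neg, ZMod.valMinAbs_natCast_of_le_half (by omega)]
    rfl
  have hle : ((x ν - (x + unitVec (fine n M) ν) ν).valMinAbs).natAbs
      ≤ Finset.univ.sup fun μ => ((x μ - (x + unitVec (fine n M) ν) μ).valMinAbs).natAbs :=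
    Finset.le_sup (f := fun μ => ((x μ - (x + unitVec (fine n M) ν) μ).valMinAbs).natAbs) (Finset.mem_univ ν)
  rw [h1] at hle
  unfold distSite
  exact_mod_cast Nat.lt_of_lt_of_le Nat.zero_lt_one hle

/-- **`|nearOf x − B(x)|_T ≤ 1`**: the nearest unit-lattice point `round(x/n)` and King's block corner `⌊x/n⌋` differ by `0` or `1` in every coordinate.
[cite: Balaban1984PropagatorsI, p.35 (T₁^{(k)} and the cubes Δ̃(y)); King1986, p.664 (blocks B^k(x))] -/
theorem tdistT_nearOf_blockOf_le (hn : 1 ≤ n) (x : Tor (fine n M)) : tdistT M (nearOf M n x) (blockOf n M x) ≤ 1 := by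
  have h := tdistT_le_of_coord M (nearOf M n x) (blockOf n M x) 1 fun μ => ?_
  · exact_mod_cast h
  have hM1 : 1 ≤ M μ := one_le_period M μ
  have hn0 : (0 : ℝ) < n := by exact_mod_cast hn
  set v : ℕ := (x μ).val with hv
  set q : ℕ := v / n with hq
  have hblk : (blockOf n M x μ).val = q := val_blockOf x μ
  have hnear : (((nearOf M n x μ).val : ℕ) : ℤ) = round (uc M n x μ) % (M μ : ℤ) := by
    unfold nearOf
    exact ZMod.val_intCast _
  -- `round (v/n) ∈ {q, q+1}`
  have h1 : ((q : ℕ) : ℝ) ≤ (v : ℝ) / n := Nat.cast_div_le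
  have h2 : (v : ℝ) / n < ((q : ℕ) : ℝ) + 1 := by
    rw [div_lt_iff₀ hn0]
    have h3 : v < n * (q + 1) := Nat.lt_mul_div_succ v hn
    have h4 : ((v : ℕ) : ℝ) < (n : ℝ) * ((q : ℝ) + 1) := by exact_mod_cast h3
    nlinarith
  have hround : round (uc M n x μ) = (q : ℤ) ∨ round (uc M n x μ) = (q : ℤ) + 1 := by
    rw [round_eq]
    have huc : uc M n x μ = (v : ℝ) / n := rfl
    have hlo : (q : ℤ) ≤ ⌊uc M n x μ + 1 / 2⌋ := Int.le_floor.mpr (by rw [huc]; push_cast; linarith)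
    have hhi : ⌊uc M n x μ + 1 / 2⌋ < (q : ℤ) + 2 := Int.floor_lt.mpr (by rw [huc]; push_cast; linarith)
    omega
  -- the integer difference is `ε − M·k` with `ε ∈ {0,1}`
  set r : ℤ := round (uc M n x μ) with hr
  have hval : (((nearOf M n x μ).val : ℕ) : ℤ) - (((blockOf n M x μ).val : ℕ) : ℤ) = (r - q) + (M μ : ℤ) * (-(r / (M μ : ℤ))) := by
    rw [hnear, hblk, Int.emod_def]; ring
  rw [hval, circAbs_add_mul]
  refine (circAbs_le_abs hM1 _).trans ?_
  rcases hround with h | h <;> simp [h]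

end Geometry

/-! ## §22 The one-step gradient difference through the HÖLDER ENTRY (1.111): `|∇_{ν′}Gμ(x + ηe_ν) − ∇_{ν′}Gμ(x)| ≤ C_α·e^{−δ₀|y₀−y′|}·(‖ζ‖_α + |ζ|)·|μ|·η^α` -/

section Step

variable (M : Fin (d + 1) → ℕ) [∀ μ, NeZero (M μ)] (n : ℕ) [NeZero n] (a : ℝ)

/-- **ONE FINE STEP COSTS `η^α` ON `∇G`, BY (1.111)**: with `ζ = cutP (nearOf x)` (plateau `= 1` at `x` and at `x + e_ν` once `n ≥ 4`, support in `Δ̃(nearOf x)`),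
`|ρ(n(s_{ν′}−1))(Gμ)(x + e_ν, κ) − ρ(n(s_{ν′}−1))(Gμ)(x, κ)| ≤ ‖ζ∇Gμ‖_α·η^α ≤ C_α(α)·e^{−δ₀|nearOf x − y′|}·(‖ζ‖_α + |ζ|)·|μ|·η^α` for `supp μ ⊂ Δ̃(y′)`
— the (1.111) clause of `B5.Ineq110_114` at the concrete setting, unpacked. [cite: Balaban1984PropagatorsI, Prop. 1.2 (1.111) p.35] -/
theorem abs_gradStep_le_of_ineq (hn : 4 ≤ n) {K : ℕ} {C δ₀ : ℝ} {Cα Cε : ℝ → ℝ} {Cαε : ℝ → ℝ → ℝ}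
    (H : B5.Ineq110_114 (latticeSettingP12R n M a K) C Cα Cε Cαε δ₀) {α : ℝ} (hα0 : 0 ≤ α) (hα1 : α < 1)
    (μ : Tor (fine n M) × Fin (d + 1) → ℝ) {y' : Tor M} (hμ : suppInL n M (LocR.vec μ).emb y') (ν ν' : Fin (d + 1))
    (x : Tor (fine n M)) (κ : Fin (d + 1)) :
    |symbOp M n (sD M n ν' n) (gOp M n a μ) (x + unitVec (fine n M) ν, κ) - symbOp M n (sD M n ν' n) (gOp M n a μ) (x, κ)|
      ≤ Cα α * Real.exp (-(δ₀ * distSite M (nearOf M n x) y')) * cutHL n M α (cutP M n (nearOf M n x))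
          * supNormL n M (LocR.vec μ).emb * ((n : ℝ)⁻¹) ^ α := by
  have hn1 : 1 ≤ n := by omega
  set ζ : Tor (fine n M) → ℝ := cutP M n (nearOf M n x) with hζ
  set T : Fin (d + 1) → VecR n M := fun ν'' b => ζ b.1 * symbOp M n (sD M n ν'' n) (gOp M n a μ) b with hT
  have h111 : h1L n M a (LocR.vec μ).emb α ζ
      ≤ Cα α * Real.exp (-(δ₀ * distSite M (nearOf M n x) y')) * cutHL n M α ζ * supNormL n M (LocR.vec μ).emb :=
    H.2.1 α (LocR.vec μ) ζ (nearOf M n x) y' hα0 hα1 (cutInL_cutP M n hn1 _) hμ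
  rw [h1L_vec_eq] at h111
  have hd1 : distU n M x (x + unitVec (fine n M) ν) ≤ 1 / n := distU_step_le n M x ν
  have hn4 : (1 : ℝ) / n ≤ 1 / 4 := by
    gcongr
    exact_mod_cast hn
  have hpair := abs_sub_le_holderT_mul α T ν' (μ := κ) (hd1.trans (hn4.trans (by norm_num))) (distU_step_pos M n (by omega) x ν)
  have hζ0 : ζ x = 1 := cutP_nearOf_eq_one M n hn1 x
  have hζ1 : ζ (x + unitVec (fine n M) ν) = 1 := cutP_nearOf_eq_one_of_distU_le M n hn1 (hd1.trans hn4)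
  have hT0 : T ν' (x, κ) = symbOp M n (sD M n ν' n) (gOp M n a μ) (x, κ) := by simp only [hT, hζ0, one_mul]
  have hT1 : T ν' (x + unitVec (fine n M) ν, κ) = symbOp M n (sD M n ν' n) (gOp M n a μ) (x + unitVec (fine n M) ν, κ) := by
    simp only [hT, hζ1, one_mul]
  rw [← hT0, ← hT1]
  have hhol0 : 0 ≤ holderT n M α (fun ν => cplx (T ν)) := by
    unfold holderT LatticeNorms.holderSeminormB5
    exact holderSeminorm_nonneg _ _ _ _ _ _
  refine hpair.trans (mul_le_mul h111 ?_ (Real.rpow_nonneg (distU_nonneg _ _) _) (hhol0.trans h111))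
  rw [← one_div]
  exact Real.rpow_le_rpow (distU_nonneg _ _) hd1 hα0

/-- **THE COARSE-STEP GRADIENT DIFFERENCE `ρ(n(s_ν−1))∘ρ(n(s_{ν′}−1))∘G` HAS THE BLOCK MAJORANT `C′·n^{1−α}·e^{−δ₀|y−y′|_T}`**, `C′ = |C_α(α)|·(Lθ+1)·e^{δ₀}`,
for every setting satisfying `B5.Ineq110_114` ((1.111) clause), `n ≥ 4`, tori with `≥ 2` unit cubes per direction: the `η^{α−1}` of a second difference quotient of `G`
in the lineage's `HasMaj` currency (King unit blocks on the carrier `unitTorusGeo L k M`). [cite: Balaban1984PropagatorsI, Prop. 1.2 (1.111) p.35] -/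
theorem hasMaj_gradStep_of_ineq {L k : ℕ} (hn : 4 ≤ n) (hM2 : ∀ μ, 2 ≤ M μ) {K : ℕ} {C δ₀ : ℝ} {Cα Cε : ℝ → ℝ} {Cαε : ℝ → ℝ → ℝ}
    (H : B5.Ineq110_114 (latticeSettingP12R n M a K) C Cα Cε Cαε δ₀) (hδ₀ : 0 ≤ δ₀) {α : ℝ} (hα0 : 0 ≤ α) (hα1 : α < 1)
    (ν ν' : Fin (d + 1)) :
    HasMaj (BlockNorm.ofBlocks (unitTorusGeo L k M) (fun i : Tor (fine n M) × Fin (d + 1) => blockOf n M i.1))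
      (BlockNorm.ofBlocks (unitTorusGeo L k M) (fun i : Tor (fine n M) × Fin (d + 1) => blockOf n M i.1))
      (symbOp M n (sD M n ν n) ∘ₗ symbOp M n (sD M n ν' n) ∘ₗ gOp M n a)
      (fun y y' => |Cα α| * (Lθ (d + 1) + 1) * Real.exp δ₀ * (n : ℝ) ^ (1 - α) * Real.exp (-(δ₀ * tdistT M y y'))) := by
  have hn1 : 1 ≤ n := by omega
  have hn0 : (0 : ℝ) < n := by exact_mod_cast (show 0 < n by omega)
  intro y' μ hμ y
  set b₁ := BlockNorm.ofBlocks (unitTorusGeo L k M) (fun i : Tor (fine n M) × Fin (d + 1) => blockOf n M i.1) with hb₁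
  have hsupp : suppInL n M (LocR.vec μ).emb y' := by
    intro b hb
    have hby : blockOf n M b.1 = y' := by
      by_contra h
      exact hb (show ((μ b : ℝ) : ℂ) = 0 by rw [hμ b h, Complex.ofReal_zero])
    rw [← hby]
    exact mem_cubeT_blockOf M n hn1 b.1
  have hsrc : supNormL n M (LocR.vec μ).emb ≤ b₁.loc y' μ := by
    refine supNorm_le (b₁.loc_nonneg y' μ) fun b _ => ?_
    show ‖((μ b : ℝ) : ℂ)‖ ≤ _
    by_cases hb : blockOf n M b.1 = y'
    · rw [Complex.norm_real, Real.norm_eq_abs]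
      exact abs_le_loc_ofBlocks (g := unitTorusGeo L k M) (fun i : Tor (fine n M) × Fin (d + 1) => blockOf n M i.1) μ hb
    · rw [hμ b hb, Complex.ofReal_zero, norm_zero]
      exact b₁.loc_nonneg y' μ
  have hK0 : 0 ≤ |Cα α| * (Lθ (d + 1) + 1) * Real.exp δ₀ * (n : ℝ) ^ (1 - α) * Real.exp (-(δ₀ * tdistT M y y')) :=
    mul_nonneg (mul_nonneg (mul_nonneg (mul_nonneg (abs_nonneg _) (by linarith [Lθ_nonneg (d + 1)])) (Real.exp_nonneg _))
      (Real.rpow_nonneg hn0.le _)) (Real.exp_nonneg _)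
  refine loc_ofBlocks_le (g := unitTorusGeo L k M) (fun i : Tor (fine n M) × Fin (d + 1) => blockOf n M i.1) _
    (mul_nonneg hK0 (b₁.loc_nonneg y' μ)) fun b hb => ?_
  obtain ⟨x, κ⟩ := b
  rw [LinearMap.comp_apply, LinearMap.comp_apply, symbOp_sD_apply, abs_mul, abs_of_pos hn0]
  have hstep := abs_gradStep_le_of_ineq M n a hn H hα0 hα1 μ hsupp ν ν' x κ
  -- the weight at `nearOf x` versus the weight at the block `y = B(x)`
  have hnear : tdistT M (nearOf M n x) (blockOf n M x) ≤ 1 := tdistT_nearOf_blockOf_le M n hn1 x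
  have hexp : Real.exp (-(δ₀ * distSite M (nearOf M n x) y')) ≤ Real.exp δ₀ * Real.exp (-(δ₀ * tdistT M y y')) := by
    have htri := distSite_triangle M y (nearOf M n x) y'
    simp only [distSite_eq_tdistT] at htri ⊢
    have hyn : tdistT M y (nearOf M n x) ≤ 1 := by
      rw [tdistT_symm, ← (show blockOf n M x = y from hb)]; exact hnear
    rw [← Real.exp_add, Real.exp_le_exp]
    have h1 : δ₀ * tdistT M y y' ≤ δ₀ * tdistT M y (nearOf M n x) + δ₀ * tdistT M (nearOf M n x) y' := by
      rw [← mul_add]; exact mul_le_mul_of_nonneg_left htri hδ₀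
    have h2 : δ₀ * tdistT M y (nearOf M n x) ≤ δ₀ := mul_le_of_le_one_right hδ₀ hyn
    linarith
  have hcut : cutHL n M α (cutP M n (nearOf M n x)) ≤ Lθ (d + 1) + 1 := cutH_le M n hM2 α _ hα1
  have h2 : Cα α * Real.exp (-(δ₀ * distSite M (nearOf M n x) y')) * cutHL n M α (cutP M n (nearOf M n x)) * supNormL n M (LocR.vec μ).emb
      ≤ |Cα α| * (Real.exp δ₀ * Real.exp (-(δ₀ * tdistT M y y'))) * (Lθ (d + 1) + 1) * b₁.loc y' μ := by
    have hE := Real.exp_nonneg (-(δ₀ * distSite M (nearOf M n x) y'))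
    have hH := cutHL_nonneg (n := n) (M := M) α (cutP M n (nearOf M n x))
    have hS := supNormL_nonneg (n := n) (M := M) (LocR.vec μ).emb
    calc Cα α * Real.exp (-(δ₀ * distSite M (nearOf M n x) y')) * cutHL n M α (cutP M n (nearOf M n x)) * supNormL n M (LocR.vec μ).emb
        ≤ |Cα α| * Real.exp (-(δ₀ * distSite M (nearOf M n x) y')) * cutHL n M α (cutP M n (nearOf M n x)) * supNormL n M (LocR.vec μ).emb := by
          gcongr; exact le_abs_self _
      _ ≤ |Cα α| * (Real.exp δ₀ * Real.exp (-(δ₀ * tdistT M y y'))) * (Lθ (d + 1) + 1) * b₁.loc y' μ := by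
          have hA := abs_nonneg (Cα α)
          have hE1 : 0 ≤ Real.exp δ₀ * Real.exp (-(δ₀ * tdistT M y y')) := by positivity
          have hL1 : 0 ≤ Lθ (d + 1) + 1 := by linarith [Lθ_nonneg (d + 1)]
          exact mul_le_mul (mul_le_mul (mul_le_mul_of_nonneg_left hexp hA) hcut hH (mul_nonneg hA hE1)) hsrc hS
            (mul_nonneg (mul_nonneg hA hE1) hL1)
  have hpow : (n : ℝ) * ((n : ℝ)⁻¹) ^ α = (n : ℝ) ^ (1 - α) := by
    rw [Real.inv_rpow hn0.le, ← Real.rpow_neg hn0.le, show (1 - α) = 1 + -α by ring, Real.rpow_add hn0, Real.rpow_one]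
  calc (n : ℝ) * |symbOp M n (sD M n ν' n) (gOp M n a μ) (x + unitVec (fine n M) ν, κ) - symbOp M n (sD M n ν' n) (gOp M n a μ) (x, κ)|
      ≤ (n : ℝ) * (|Cα α| * (Real.exp δ₀ * Real.exp (-(δ₀ * tdistT M y y'))) * (Lθ (d + 1) + 1) * b₁.loc y' μ * ((n : ℝ)⁻¹) ^ α) :=
        mul_le_mul_of_nonneg_left (hstep.trans (mul_le_mul_of_nonneg_right h2 (Real.rpow_nonneg (inv_nonneg.mpr hn0.le) _))) hn0.le
    _ = |Cα α| * (Lθ (d + 1) + 1) * Real.exp δ₀ * ((n : ℝ) * ((n : ℝ)⁻¹) ^ α) * Real.exp (-(δ₀ * tdistT M y y')) * b₁.loc y' μ := by ring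
    _ = _ := by rw [hpow]

end Step

/-! ## §23 A coarse difference quotient costs at most `2c·e^{ρ}` (no Hölder): the small-`n` fallback -/

section Crude

variable {L : ℕ} (M : Fin (d + 1) → ℕ) [∀ μ, NeZero (M μ)] (k n : ℕ) [NeZero n] {F₁ : Type} [AddCommGroup F₁] [Module ℝ F₁]

/-- `ρ(c(s_ν − 1))∘T` has majorant `2cB·e^{ρ}` whenever `T` has `B·e^{−ρd}` (`c ≥ 0`, `n ≥ 1`; part 40's shift transfer). [folklore] -/
theorem hasMaj_sD_comp {b₁ : BlockNorm (unitTorusGeo L k M) F₁} {T : F₁ →ₗ[ℝ] (Tor (fine n M) × Fin (d + 1) → ℝ)} {B ρ : ℝ}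
    (hB : 0 ≤ B) (hρ : 0 ≤ ρ) (ν : Fin (d + 1)) {c : ℝ} (hc : 0 ≤ c) (hn : 1 ≤ n)
    (h : HasMaj b₁ (BlockNorm.ofBlocks (unitTorusGeo L k M) (fun i : Tor (fine n M) × Fin (d + 1) => blockOf n M i.1)) T
      (fun y y' => B * Real.exp (-(ρ * tdistT M y y')))) :
    HasMaj b₁ (BlockNorm.ofBlocks (unitTorusGeo L k M) (fun i : Tor (fine n M) × Fin (d + 1) => blockOf n M i.1)) (symbOp M n (sD M n ν c) ∘ₗ T)
      (fun y y' => 2 * c * B * Real.exp ρ * Real.exp (-(ρ * tdistT M y y'))) := by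
  rw [sD, map_smul, map_sub, map_one, LinearMap.smul_comp, LinearMap.sub_comp, Module.End.one_eq_id, LinearMap.id_comp]
  have h1 := hasMaj_sT_pow_comp M k n hB hρ ν (j := 1) hn h
  rw [pow_one] at h1
  have h0 : HasMaj b₁ (BlockNorm.ofBlocks (unitTorusGeo L k M) (fun i : Tor (fine n M) × Fin (d + 1) => blockOf n M i.1)) T
      (fun y y' => B * Real.exp ρ * Real.exp (-(ρ * tdistT M y y'))) :=
    h.mono fun y y' => mul_le_mul_of_nonneg_right (le_mul_of_one_le_right hB (Real.one_le_exp hρ)) (Real.exp_nonneg _)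
  refine (hasMaj_smul_ofBlocks (g := unitTorusGeo L k M) (fun i : Tor (fine n M) × Fin (d + 1) => blockOf n M i.1)
    (fun y y' => add_nonneg (mul_nonneg (mul_nonneg hB (Real.exp_nonneg _)) (Real.exp_nonneg _))
      (mul_nonneg (mul_nonneg hB (Real.exp_nonneg _)) (Real.exp_nonneg _))) c (h1.sub h0)).mono fun y y' => le_of_eq ?_
  show |c| * (B * Real.exp ρ * Real.exp (-(ρ * tdistT M y y')) + B * Real.exp ρ * Real.exp (-(ρ * tdistT M y y'))) = _
  rw [abs_of_nonneg hc]
  ring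

end Crude

/-! ## §24 THE FAMILY OF RECORD: `η^{α−1}`-majorants of `∇∇G` for every torus exponent `m` and top scale `K ≥ 1`, one pair `(δ₀, C)` -/

section Family

/-- ★★ **(1.111) AS THE `η^α` GAIN OF THE COARSE-STEP GRADIENT DIFFERENCE, HYPOTHESIS-FREE ON THE TORUS FAMILY OF RECORD**: for odd `L > 1`, `a > 0` and `0 ≤ α < 1`
there are `δ₀, C > 0` such that for EVERY `m`, EVERY `K ≥ 1` and all directions `ν, ν′`, the real operator `ρ(n(s_ν − 1))∘ρ(n(s_{ν′} − 1))∘G`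
(`n = L^K = η⁻¹`, `G = Δ_a⁻¹ = gOp (2L^m) (L^K) a`) has the block majorant `C·n^{1−α}·e^{−δ₀|y−y′|_T}` on the N15 carrier — i.e. `η·∇_ν∇_{ν′}G = O(η^α)`
blockwise with exponential decay.  From Bałaban's Proposition 1.2, Hölder entry (1.111) (`B5Prop12GHolds.prop12_famG_printed`, kernel-proved in the tree) through
§22 for `L^K ≥ 4`, and from the (1.110) entry «∇GJ» (part 39 `hasMaj_entries110`) with the crude §23 for the finitely many `L^K < 4`.  This is the regularity
input of the two-grid defect estimate (door (iv) R3): the consistency operator of part 35 produces exactly `ρ′(sD_ν c′)ρ′(k_ν)·P·ρ(sD_ν c)²G`.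
[cite: Balaban1984PropagatorsI, Prop. 1.2 (1.110)–(1.111) p.35] -/
theorem hasMaj_gradStep {L : ℕ} [NeZero L] (hL : Odd L ∧ 1 < L) {a : ℝ} (ha : 0 < a) {α : ℝ} (hα0 : 0 ≤ α) (hα1 : α < 1) :
    ∃ δ₀ C : ℝ, 0 < δ₀ ∧ 0 < C ∧ ∀ (m K : ℕ) (hK : 1 ≤ K) (ν ν' : Fin (d + 1)),
      HasMaj (BlockNorm.ofBlocks (unitTorusGeo L K (MP (paramsOf d L m K hL))) (blkFine L K (MP (paramsOf d L m K hL))))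
        (BlockNorm.ofBlocks (unitTorusGeo L K (MP (paramsOf d L m K hL))) (blkFine L K (MP (paramsOf d L m K hL))))
        (symbOp (MP (paramsOf d L m K hL)) (L ^ K) (sD (MP (paramsOf d L m K hL)) (L ^ K) ν ((L ^ K : ℕ) : ℝ)) ∘ₗ
          symbOp (MP (paramsOf d L m K hL)) (L ^ K) (sD (MP (paramsOf d L m K hL)) (L ^ K) ν' ((L ^ K : ℕ) : ℝ)) ∘ₗ
            gOp (MP (paramsOf d L m K hL)) (L ^ K) a)
        (fun y y' => C * ((L ^ K : ℕ) : ℝ) ^ (1 - α) * Real.exp (-(δ₀ * tdistT (MP (paramsOf d L m K hL)) y y'))) := by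
  obtain ⟨δH, CH0, Cα, Cε, Cαε, hδH, _hCH0, H⟩ := prop12_famG_printed (d := d + 1) (L := L) (Nat.succ_pos d) hL ha
  obtain ⟨δ₁, C₁, hδ₁, hC₁, H1⟩ := hasMaj_entries110 (d := d) hL ha
  set CH : ℝ := |Cα α| * (Lθ (d + 1) + 1) * Real.exp δH with hCH
  set CF : ℝ := 8 * C₁ * Real.exp δ₁ with hCF
  have hCH0' : 0 ≤ CH := mul_nonneg (mul_nonneg (abs_nonneg _) (by linarith [Lθ_nonneg (d + 1)])) (Real.exp_nonneg _)
  have hCF0 : 0 < CF := by positivity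
  refine ⟨min δH δ₁, CH + CF, lt_min hδH hδ₁, by linarith, fun m K hK ν ν' => ?_⟩
  set M : Fin (d + 1) → ℕ := MP (paramsOf d L m K hL) with hM
  have hL0 : 0 < L := Nat.pos_of_ne_zero (NeZero.ne L)
  have hM2 : ∀ μ, 2 ≤ M μ := fun μ => Nat.le_mul_of_pos_right 2 (pow_pos hL0 m)
  have hn1 : 1 ≤ L ^ K := Nat.one_le_pow _ _ hL0
  have hn0 : (0 : ℝ) < ((L ^ K : ℕ) : ℝ) := by exact_mod_cast hn1
  have hX : 0 ≤ ((L ^ K : ℕ) : ℝ) ^ (1 - α) := Real.rpow_nonneg hn0.le _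
  have hEH : ∀ y y' : Tor M, Real.exp (-(δH * tdistT M y y')) ≤ Real.exp (-(min δH δ₁ * tdistT M y y')) := fun y y' =>
    Real.exp_le_exp.mpr (by nlinarith [min_le_left δH δ₁, tdistT_nonneg M y y'])
  have hE1 : ∀ y y' : Tor M, Real.exp (-(δ₁ * tdistT M y y')) ≤ Real.exp (-(min δH δ₁ * tdistT M y y')) := fun y y' =>
    Real.exp_le_exp.mpr (by nlinarith [min_le_right δH δ₁, tdistT_nonneg M y y'])
  by_cases h4 : 4 ≤ L ^ K
  · have hmain := hasMaj_gradStep_of_ineq (L := L) (k := K) M (L ^ K) a h4 hM2 (H (topIdxOf d L m K hL hK)) hδH.le hα0 hα1 ν ν'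
    refine hmain.mono fun y y' => ?_
    have hE := Real.exp_nonneg (-(min δH δ₁ * tdistT M y y'))
    calc |Cα α| * (Lθ (d + 1) + 1) * Real.exp δH * ((L ^ K : ℕ) : ℝ) ^ (1 - α) * Real.exp (-(δH * tdistT M y y'))
        ≤ CH * ((L ^ K : ℕ) : ℝ) ^ (1 - α) * Real.exp (-(min δH δ₁ * tdistT M y y')) :=
          mul_le_mul_of_nonneg_left (hEH y y') (mul_nonneg hCH0' hX)
      _ ≤ (CH + CF) * ((L ^ K : ℕ) : ℝ) ^ (1 - α) * Real.exp (-(min δH δ₁ * tdistT M y y')) := by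
          have : 0 ≤ CF * ((L ^ K : ℕ) : ℝ) ^ (1 - α) * Real.exp (-(min δH δ₁ * tdistT M y y')) := mul_nonneg (mul_nonneg hCF0.le hX) hE
          nlinarith
  · have hT := (H1 m K hK ν').1
    have hF := hasMaj_sD_comp M K (L ^ K) hC₁.le hδ₁.le ν (c := ((L ^ K : ℕ) : ℝ)) hn0.le hn1 hT
    refine hF.mono fun y y' => ?_
    have hE := Real.exp_nonneg (-(min δH δ₁ * tdistT M y y'))
    have hn4 : ((L ^ K : ℕ) : ℝ) ≤ 4 * ((L ^ K : ℕ) : ℝ) ^ (1 - α) := by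
      have hle : ((L ^ K : ℕ) : ℝ) ≤ 4 := by exact_mod_cast (show L ^ K ≤ 4 by omega)
      have e : ((L ^ K : ℕ) : ℝ) = ((L ^ K : ℕ) : ℝ) ^ α * ((L ^ K : ℕ) : ℝ) ^ (1 - α) := by
        rw [← Real.rpow_add hn0, add_sub_cancel, Real.rpow_one]
      have h1 : ((L ^ K : ℕ) : ℝ) ^ α ≤ (4 : ℝ) ^ α := Real.rpow_le_rpow hn0.le hle hα0
      have h2 : (4 : ℝ) ^ α ≤ (4 : ℝ) ^ (1 : ℝ) := Real.rpow_le_rpow_of_exponent_le (by norm_num) hα1.le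
      rw [Real.rpow_one] at h2
      calc ((L ^ K : ℕ) : ℝ) = ((L ^ K : ℕ) : ℝ) ^ α * ((L ^ K : ℕ) : ℝ) ^ (1 - α) := e
        _ ≤ 4 * ((L ^ K : ℕ) : ℝ) ^ (1 - α) := mul_le_mul_of_nonneg_right (h1.trans h2) hX
    calc 2 * ((L ^ K : ℕ) : ℝ) * C₁ * Real.exp δ₁ * Real.exp (-(δ₁ * tdistT M y y'))
        ≤ 2 * (4 * ((L ^ K : ℕ) : ℝ) ^ (1 - α)) * C₁ * Real.exp δ₁ * Real.exp (-(min δH δ₁ * tdistT M y y')) := by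
          have := hE1 y y'
          have hC := hC₁.le
          have hexp := Real.exp_nonneg δ₁
          gcongr
      _ = CF * ((L ^ K : ℕ) : ℝ) ^ (1 - α) * Real.exp (-(min δH δ₁ * tdistT M y y')) := by rw [hCF]; ring
      _ ≤ (CH + CF) * ((L ^ K : ℕ) : ℝ) ^ (1 - α) * Real.exp (-(min δH δ₁ * tdistT M y y')) := by
          have : 0 ≤ CH * ((L ^ K : ℕ) : ℝ) ^ (1 - α) * Real.exp (-(min δH δ₁ * tdistT M y y')) := mul_nonneg (mul_nonneg hCH0' hX) hE
          nlinarith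

end Family

end Summit.QuantumFields.YangMills.BalabanUVNodes.N15.TwoGrid
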